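import Summits.BirchSwinnertonDyer.BirchSwinnertonDyer.Theorems.ManinLocalTwoThreeShimuraCoverMuThreeHolds
import HarnessLib

/-!
# `5 ∣ [Λ₀(f) : Λ₁(f)]` forces `11 ∣ N` — part 1/3: group-theoretic helpers (es g43, road β; MEMO-es §65, row E-es-221)

Route `ManinLocalTwoThree`, crux C2 `ManinOddAtFour` stmt-BirchSwinnertonDyer-22967 (helper).  Elementary lemmas used by
`Theorems/ManinLocalTwoThreeShimuraFiveCoverKernel.lean` (THEOREM A: the Shimura-cover kernel at an odd prime `p` gives
`W₀[p] = ⟨t⟩ ⊕ μ_p`) and `Theorems/ManinLocalTwoThreeShimuraFiveForcesEleven.lean` (`5 ∣ [Λ₀(f):Λ₁(f)] ⟹ 11 ∣ N`, the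
prime-level Derickx–Orlić law for `q ∉ {11, 17}`): subgroups of a group of order `p²`, elements of a cyclic group of prime order
as natural multiples, powers under a bi-additive pairing, rational roots of unity of odd order.

HONEST FRAMING: unconditional tree theorems (standard axioms); no definitions, no named facts, no sorry.  C2, C3, Manin's conjecture
and BSD are NOT proved by this file. [folklore] [cite: SilvermanAEC2009, III.8.1]
-/

set_option linter.dupNamespace false
set_option autoImplicit false

noncomputable section

open scoped Classical MatrixGroups ModularForm PeriodPair

open CongruenceSubgroup WeierstrassCurve Field Polynomial NumberField IsDedekindDomain IsDedekindDomain.HeightOneSpectrum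
  Literature.NumberTheory.EllipticCurves
  Literature.NumberTheory.EllipticCurves.ModularForms Summit.BirchSwinnertonDyer.Rank1Residual
  Summit.BirchSwinnertonDyer.Rank1Residual.ManinAdditive Summit.BirchSwinnertonDyer.Rank1Residual.ManinAdditive.KatoCurve
  Summit.BirchSwinnertonDyer.Rank1Residual.ManinAdditive.ShimuraCover
  Summit.BirchSwinnertonDyer.BirchSwinnertonDyer.Theorems.ManinLocalTwoThree
  Summit.BirchSwinnertonDyer.BirchSwinnertonDyer.Theorems.ManinLocalTwoThree.CuspGalois
  Summit.BirchSwinnertonDyer.BirchSwinnertonDyer.Theorems.ManinLocalTwoThree.ShimuraCoverHolds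

namespace Summit.BirchSwinnertonDyer.BirchSwinnertonDyer.Theorems.ManinLocalTwoThree.ShimuraFive

/-! ### §1. Group-theoretic helpers -/

/-- A rational root of unity of ODD order is `1`. [folklore] -/
theorem rat_eq_one_of_pow_eq_one_of_odd {q : ℚ} {n : ℕ} (hn : Odd n) (hq : q ^ n = 1) : q = 1 := by
  have h : (fun a : ℚ ↦ a ^ n) q = (fun a : ℚ ↦ a ^ n) 1 := by simp only [one_pow]; exact hq
  exact (hn.strictMono_pow (R := ℚ)).injective h

/-- In a group of order `p²` (`p` prime) a proper subgroup through `a ≠ 0` with `p • a = 0` is `⟨a⟩`, of order `p`. [folklore] -/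
theorem eq_zmultiples_of_card_eq_sq {G : Type*} [AddCommGroup G] {p : ℕ} (hp : p.Prime) (hG : Nat.card G = p ^ 2)
    {K : AddSubgroup G} {a : G} (ha : a ∈ K) (ha0 : a ≠ 0) (hpa : p • a = 0) (hK : K ≠ ⊤) :
    K = AddSubgroup.zmultiples a ∧ Nat.card K = p := by
  haveI : Finite G := Nat.finite_of_card_ne_zero (by rw [hG]; exact pow_ne_zero 2 hp.ne_zero)
  have horder : addOrderOf a = p := by
    rcases (Nat.dvd_prime hp).mp (addOrderOf_dvd_of_nsmul_eq_zero hpa) with h1 | h1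
    · exact absurd (AddMonoid.addOrderOf_eq_one_iff.mp h1) ha0
    · exact h1
  have hle : AddSubgroup.zmultiples a ≤ K := (AddSubgroup.zmultiples_le).mpr ha
  have hdvd : Nat.card K ∣ Nat.card G := AddSubgroup.card_addSubgroup_dvd_card K
  rw [hG] at hdvd
  obtain ⟨i, hi, hi'⟩ := (Nat.dvd_prime_pow hp).mp hdvd
  have hKbot : K ≠ ⊥ := fun hbot ↦ ha0 (by rw [hbot, AddSubgroup.mem_bot] at ha; exact ha)
  interval_cases i
  · exact absurd (AddSubgroup.eq_bot_of_card_eq K (by rw [hi', pow_zero])) hKbot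
  · rw [pow_one] at hi'
    refine ⟨(AddSubgroup.eq_of_le_of_card_ge hle ?_).symm, hi'⟩
    rw [hi', Nat.card_zmultiples, horder]
  · exact absurd ((AddSubgroup.card_eq_iff_eq_top K).mp (hi'.trans hG.symm)) hK

/-- The elements of `⟨a⟩`, `p • a = 0`, are the `n • a` with `n < p`. [folklore] -/
theorem exists_nsmul_eq_of_mem_zmultiples {G : Type*} [AddCommGroup G] {p : ℕ} (hp : 0 < p) {a x : G}
    (hpa : p • a = 0) (hx : x ∈ AddSubgroup.zmultiples a) : ∃ n : ℕ, n < p ∧ x = n • a := by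
  obtain ⟨m, rfl⟩ := AddSubgroup.mem_zmultiples_iff.mp hx
  have hp' : (0 : ℤ) < p := by exact_mod_cast hp
  have h0 : 0 ≤ m % p := Int.emod_nonneg m hp'.ne'
  have hlt : m % p < p := Int.emod_lt_of_pos m hp'
  refine ⟨(m % p).toNat, by omega, ?_⟩
  have hpa' : (p : ℤ) • a = 0 := by rw [natCast_zsmul]; exact hpa
  calc m • a = (m % p + p * (m / p)) • a := by rw [Int.emod_add_mul_ediv]
    _ = (m % p) • a + (m / p) • ((p : ℤ) • a) := by rw [add_zsmul, mul_comm, mul_zsmul]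
    _ = ((m % p).toNat : ℤ) • a := by rw [hpa', zsmul_zero, add_zero, Int.toNat_of_nonneg h0]
    _ = (m % p).toNat • a := natCast_zsmul a _

/-- A bi-additive pairing is a power map in the second variable. [folklore] -/
theorem pairing_nsmul_right {G F : Type*} [AddCommGroup G] [Field F] {e : G → G → F}
    (haddr : ∀ S T₁ T₂, e S (T₁ + T₂) = e S T₁ * e S T₂) (he0 : ∀ S, e S 0 = 1) (S T : G) (n : ℕ) :
    e S (n • T) = e S T ^ n := by
  induction n with
  | zero => rw [zero_nsmul, pow_zero, he0]
  | succ n ih => rw [succ_nsmul, haddr, ih, pow_succ]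

/-- A group action commutes with natural multiples. [folklore] -/
theorem smul_nsmul_comm {M A : Type*} [Monoid M] [AddCommGroup A] [DistribMulAction M A] (τ : M) (n : ℕ) (X : A) :
    τ • (n • X) = n • (τ • X) := by
  induction n with
  | zero => rw [zero_nsmul, zero_nsmul, smul_zero]
  | succ n ih => rw [succ_nsmul, succ_nsmul, smul_add, ih]

end Summit.BirchSwinnertonDyer.BirchSwinnertonDyer.Theorems.ManinLocalTwoThree.ShimuraFive

end
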